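import Summits.QuantumFields.YangMills.Theorems.LuscherReductionTwistedTraceScalingBaseWindow
import HarnessLib

/-!
# S-BASE of line «twolattice» (crux `TwistedTraceScaling`, stmt-QuantumFields-20203) REDUCED to three fixed-lattice level
# statements `COARSE±(L₁)` + `CoarseTail(L₁)` — the composition, kernel-checked (no sorry, no new definitions)

Route `LuscherReduction` (owner ym-beyond-p1), child crux `TwistedTraceScaling` (stmt-QuantumFields-20203), registered birth line
«twolattice» (`pub/ym-beyond/p1-g20-files/Lines-twolattice.lean`, sha16 a5c3dbcbf75f28d1).  Its stub S-BASE

  `Stmt.stub_fixedLatticeTraceLaw := ∀ L₁ s > 0, ε > 0, ∃ β₁, ∀ β ≥ β₁, |traceRatio L₁ β (femtoSteps s β L₁) − hTraceRatio s| ≤ ε`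

(fixed lattice `(ℤ/L₁)³`, `β → ∞`: the zero-flux dyadic trace ratio at `T = ⌈sL₁/Λ(β,L₁)⌉` tends to Lüscher's `r_𝔥(s)`) is sized «L»
on the card but is the FULL fixed-lattice analogue of crux ONE (all levels, both directions) PLUS a `β`-uniform tail bound — on the
compact configuration space `SU(2)^{3L₁³}` with gauge and twist symmetry.  This file isolates exactly that content.  For a lattice
size `L₁` write `λ_k = levelValue su2Rep L₁ β k`, `u = Λ(β,L₁)/L₁` (femto energy unit per transfer step), `Δ_k = levelGap k`:

* `COARSE-UPPER(L₁)` = VERBATIM the body of KTR r8's `CoarseNoIntruderAt L₁` (stub 3b′ of the KT door is the instance `L₁ = 2`):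
  for every `k` and `d < Δ_k`, deep in the window AT `L₁`, `λ_k ≤ e^{−d·u} λ_0` (no intruders: fixed-lattice semiclassics from below);
* `COARSE-LOWER(L₁)` = VERBATIM the body of KTR r8's `CoarseLowerAt L₁`: for every `k` and `ε > 0`, deep in the window,
  `e^{−(Δ_k+ε)·u} λ_0 ≤ λ_k` (trial functions);
* `COARSE-TAIL(L₁)` (new text, the fixed-lattice twin of the closed child `OneSiteTail`, window currency): for every `s > 0`, `ε > 0`
  there are `K`, `lam0` such that deep in the window, for every `T` with `s ≤ 2T·u`, `Σ_k (λ_{k+K}/λ_0)^T ≤ ε`.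

THEOREM `Base.fixedLatticeTraceLaw_of_coarse (L₁) : COARSE-UPPER(L₁) → COARSE-LOWER(L₁) → COARSE-TAIL(L₁) → ⟨S-BASE at L₁⟩` and
`Base.stmt_of_coarse : (∀ L₁, the three) → ⟨body of Stmt.stub_fixedLatticeTraceLaw⟩` (verbatim).  Everything else is TREE:
window bookkeeping (`β → ∞` at fixed `L₁` ⇔ `lam → 0` in `InFemtoWindow lam β L₁`; the two-loop label is unbounded in `β`:
`invRunningCoupling_ge'`), LEVEL = TRACE currency on any lattice (`traceRatio_eq_levelRatio`, from the closed child `TraceFormula`,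
`TT.traceFormula_all`), `T·u ∈ [s, s+u]` at `T = femtoSteps`, termwise / moment / ratio limits ported from PART 8 «OST»
(`TraceDoor.OST.*`, ym-infvol-p1 g4) with ONE ↦ COARSE±, `OneSiteTail` ↦ COARSE-TAIL, `λ_b(B)` ↦ `u`; `LevelGapSummable` =
`LGS.levelGapSummable_all`.

So S-BASE = {COARSE-UPPER, COARSE-LOWER, COARSE-TAIL}(all `L₁`) and NOTHING ELSE; COARSE-UPPER(2) is at the same time the residual of
the KT door's stub 3b′ (`BOHandover.coarseNoIntruderAt_of_boUpper`: it follows from the lattice-only Born–Oppenheimer comparison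
`BO(L₁)` + ONE).  HONEST FRAMING: a reduction; the three hypotheses are OPEN fixed-lattice semiclassics (each at least L-sized);
femto rung R2b1 only; not infinite volume, not a gap, not Clay.
-/

set_option autoImplicit false

noncomputable section

open MeasureTheory Filter Topology Real
open Literature.MathematicalPhysics.QuantumFieldTheory hiding SU2
open Literature.MathematicalPhysics.QuantumLattice
open Literature.Analysis.OperatorTheory.YMMatrixModel
open scoped BigOperators

namespace Summit.QuantumFields.YangMills.Theorems.FemtoTransferGap.TwoLattice

open Summit.QuantumFields.YangMills.Theorems.FemtoTransferGap
open Summit.QuantumFields.YangMills.Theorems.FemtoTransferGap.TraceDoor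
open Summit.QuantumFields.YangMills.Theorems.FemtoTransferGap.TT (physTrace)

namespace Base

/-! ## §3 Termwise, moment and ratio limits (PART 8 «OST» with ONE ↦ COARSE±, `OneSiteTail` ↦ COARSE-TAIL, `λ_b` ↦ `u`) -/

variable (L1 : ℕ) [NeZero L1]
set_option maxHeartbeats 400000 in
/-- **Termwise limit from COARSE±(L₁).**  For each level `k`: `|x_k(β)^T − e^{−sΔ_k}| ≤ ε` for all large `β` and every `T` with
`s ≤ T·u ≤ s + 2u` (`u = Λ(β,L₁)/L₁`). -/
theorem term_close
    (hUp : ∀ k : ℕ, ∀ d : ℝ, d < levelGap k → ∃ lam0 : ℝ, 0 < lam0 ∧ ∀ lam : ℝ, 0 < lam → lam ≤ lam0 →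
      ∀ β : ℝ, InFemtoWindow lam β L1 →
        levelValue su2Rep L1 β k ≤ Real.exp (-(d * luscherLambda β L1) / L1) * levelValue su2Rep L1 β 0)
    (hLow : ∀ k : ℕ, ∀ ε : ℝ, 0 < ε → ∃ lam0 : ℝ, 0 < lam0 ∧ ∀ lam : ℝ, 0 < lam → lam ≤ lam0 →
      ∀ β : ℝ, InFemtoWindow lam β L1 →
        Real.exp (-((levelGap k + ε) * luscherLambda β L1) / L1) * levelValue su2Rep L1 β 0 ≤ levelValue su2Rep L1 β k)
    (k : ℕ) {s : ℝ} (hs : 0 < s) {ε : ℝ} (hε : 0 < ε) :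
    ∃ β1 : ℝ, ∀ β : ℝ, β1 ≤ β → ∀ T : ℕ, s ≤ (T : ℝ) * (luscherLambda β L1 / L1) →
      (T : ℝ) * (luscherLambda β L1 / L1) ≤ s + 2 * (luscherLambda β L1 / L1) →
        |(levelValue su2Rep L1 β k / levelValue su2Rep L1 β 0) ^ T - Real.exp (-s * levelGap k)| ≤ ε := by
  have hΔ : 0 ≤ levelGap k := levelGap_nonneg k
  set m : ℝ := min 1 (ε / 2) with hm
  have hmpos : 0 < m := lt_min one_pos (by positivity)
  have hm1 : m ≤ 1 := min_le_left _ _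
  have hmε : m ≤ ε / 2 := min_le_right _ _
  -- the gap slack `η` and the unit smallness `τ`
  set η : ℝ := m / (2 * (s + 1)) with hη
  have hηpos : 0 < η := by rw [hη]; positivity
  have hηs : η * s ≤ m / 2 := by
    rw [hη, div_mul_eq_mul_div, div_le_iff₀ (by positivity)]
    nlinarith [hmpos.le, hs.le]
  set τ : ℝ := m / (4 * (levelGap k + η + 1)) with hτ
  have hτpos : 0 < τ := by rw [hτ]; positivity
  have hτb : 2 * (levelGap k + η) * τ ≤ m / 2 := by
    rw [hτ]
    have hD : 0 < levelGap k + η + 1 := by positivity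
    rw [show 2 * (levelGap k + η) * (m / (4 * (levelGap k + η + 1))) =
        m / 2 * ((levelGap k + η) / (levelGap k + η + 1)) by field_simp; ring]
    have : (levelGap k + η) / (levelGap k + η + 1) ≤ 1 := by rw [div_le_one hD]; linarith
    calc m / 2 * ((levelGap k + η) / (levelGap k + η + 1)) ≤ m / 2 * 1 :=
          mul_le_mul_of_nonneg_left this (by positivity)
      _ = m / 2 := mul_one _
  -- COARSE-UPPER at `d = Δ_k − η`, COARSE-LOWER at `η`, thresholds in `β`
  obtain ⟨lamU, hlamU, hU⟩ := hUp k (levelGap k - η) (by linarith)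
  obtain ⟨lamL, hlamL, hL⟩ := hLow k η hηpos
  obtain ⟨βU, hβU⟩ := eventually_of_window L1 hlamU hU
  obtain ⟨βL, hβL⟩ := eventually_of_window L1 hlamL hL
  obtain ⟨βτ, hβτ⟩ := eventually_unit_le L1 hτpos
  refine ⟨max βU (max βL βτ), fun β hβ T hT1 hT2 => ?_⟩
  have hβU' : βU ≤ β := le_trans (le_max_left _ _) hβ
  have hβL' : βL ≤ β := le_trans ((le_max_left _ _).trans (le_max_right _ _)) hβ
  have hβτ' : βτ ≤ β := le_trans ((le_max_right _ _).trans (le_max_right _ _)) hβ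
  obtain ⟨_, hupos, huτ⟩ := hβτ β hβτ'
  have hup := hβU β hβU'
  have hlow := hβL β hβL'
  set u : ℝ := luscherLambda β L1 / L1 with hu
  set Δ := levelGap k with hΔdef
  have hpos0 : 0 < levelValue su2Rep L1 β 0 := levelValue_zero_su2Rep_pos L1 β
  set x := levelValue su2Rep L1 β k / levelValue su2Rep L1 β 0 with hx
  have e1 : -((Δ - η) * luscherLambda β L1) / L1 = -((Δ - η) * u) := by rw [hu]; ring
  have e2 : -((Δ + η) * luscherLambda β L1) / L1 = -((Δ + η) * u) := by rw [hu]; ring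
  rw [e1] at hup
  rw [e2] at hlow
  have hxup : x ≤ Real.exp (-((Δ - η) * u)) := by rw [hx, div_le_iff₀ hpos0]; exact hup
  have hxlow : Real.exp (-((Δ + η) * u)) ≤ x := by rw [hx, le_div_iff₀ hpos0]; exact hlow
  have hxpos : 0 < x := lt_of_lt_of_le (Real.exp_pos _) hxlow
  have hTup : x ^ T ≤ Real.exp (-((Δ - η) * u)) ^ T := pow_le_pow_left₀ hxpos.le hxup T
  have hTlow : Real.exp (-((Δ + η) * u)) ^ T ≤ x ^ T := pow_le_pow_left₀ (Real.exp_pos _).le hxlow T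
  rw [← Real.exp_nat_mul] at hTup hTlow
  -- ρ := η s + 2 (Δ + η) u ≤ m ≤ min 1 (ε/2)
  set ρ : ℝ := η * s + 2 * (Δ + η) * u with hρ
  have hρ0 : 0 ≤ ρ := by rw [hρ]; positivity
  have hρm : ρ ≤ m := by
    have : 2 * (Δ + η) * u ≤ 2 * (Δ + η) * τ := mul_le_mul_of_nonneg_left huτ (by positivity)
    linarith
  have hρ1 : ρ ≤ 1 := hρm.trans hm1
  have hρε : ρ ≤ ε / 2 := hρm.trans hmε
  have hTu0 : 0 ≤ (T : ℝ) * u := by positivity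
  -- exponents
  have key1 : (T : ℝ) * -((Δ - η) * u) ≤ -(s * Δ) + ρ := by
    have h1 : (T : ℝ) * -((Δ - η) * u) = -(Δ * ((T : ℝ) * u)) + η * ((T : ℝ) * u) := by ring
    rw [h1, hρ]
    have h2 : Δ * s ≤ Δ * ((T : ℝ) * u) := mul_le_mul_of_nonneg_left hT1 hΔ
    have h3 : η * ((T : ℝ) * u) ≤ η * (s + 2 * u) := mul_le_mul_of_nonneg_left hT2 hηpos.le
    have h4 : 0 ≤ 2 * Δ * u := by positivity
    nlinarith
  have key2 : -(s * Δ) - ρ ≤ (T : ℝ) * -((Δ + η) * u) := by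
    have h1 : (T : ℝ) * -((Δ + η) * u) = -((Δ + η) * ((T : ℝ) * u)) := by ring
    rw [h1, hρ]
    have h2 : (Δ + η) * ((T : ℝ) * u) ≤ (Δ + η) * (s + 2 * u) := mul_le_mul_of_nonneg_left hT2 (by positivity)
    nlinarith
  have hxT_up : x ^ T ≤ Real.exp (-(s * Δ) + ρ) := hTup.trans (Real.exp_le_exp.2 key1)
  have hxT_low : Real.exp (-(s * Δ) - ρ) ≤ x ^ T := (Real.exp_le_exp.2 key2).trans hTlow
  have hfin := abs_sub_exp_le_of_sandwich (mul_nonneg hs.le hΔ) hρ0 hρ1 hxT_low hxT_up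
  rw [show -s * Δ = -(s * Δ) by ring]
  linarith

/-- **Uniform moment limit from COARSE±(L₁) + COARSE-TAIL(L₁) + `LevelGapSummable`.**  `|m(L₁,β,T) − Σ_k e^{−sΔ_k}| ≤ ε` (and the
series converges) for all large `β` and every `T` with `s ≤ T·u ≤ s + 2u`. -/
theorem moment_close
    (hUp : ∀ k : ℕ, ∀ d : ℝ, d < levelGap k → ∃ lam0 : ℝ, 0 < lam0 ∧ ∀ lam : ℝ, 0 < lam → lam ≤ lam0 →
      ∀ β : ℝ, InFemtoWindow lam β L1 →
        levelValue su2Rep L1 β k ≤ Real.exp (-(d * luscherLambda β L1) / L1) * levelValue su2Rep L1 β 0)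
    (hLow : ∀ k : ℕ, ∀ ε : ℝ, 0 < ε → ∃ lam0 : ℝ, 0 < lam0 ∧ ∀ lam : ℝ, 0 < lam → lam ≤ lam0 →
      ∀ β : ℝ, InFemtoWindow lam β L1 →
        Real.exp (-((levelGap k + ε) * luscherLambda β L1) / L1) * levelValue su2Rep L1 β 0 ≤ levelValue su2Rep L1 β k)
    (hTail : ∀ s : ℝ, 0 < s → ∀ ε : ℝ, 0 < ε → ∃ K : ℕ, ∃ lam0 : ℝ, 0 < lam0 ∧ ∀ lam : ℝ, 0 < lam → lam ≤ lam0 →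
      ∀ β : ℝ, InFemtoWindow lam β L1 → ∀ T : ℕ, s ≤ 2 * ((T : ℝ) * (luscherLambda β L1 / L1)) →
        ∑' k : ℕ, (levelValue su2Rep L1 β (k + K) / levelValue su2Rep L1 β 0) ^ T ≤ ε)
    {s : ℝ} (hs : 0 < s) {ε : ℝ} (hε : 0 < ε) :
    ∃ β2 : ℝ, ∀ β : ℝ, β2 ≤ β → ∀ T : ℕ, s ≤ (T : ℝ) * (luscherLambda β L1 / L1) →
      (T : ℝ) * (luscherLambda β L1 / L1) ≤ s + 2 * (luscherLambda β L1 / L1) →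
        Summable (fun k : ℕ => (levelValue su2Rep L1 β k / levelValue su2Rep L1 β 0) ^ T) ∧
        |(∑' k : ℕ, (levelValue su2Rep L1 β k / levelValue su2Rep L1 β 0) ^ T) - ∑' k : ℕ, Real.exp (-s * levelGap k)| ≤ ε := by
  have hε4 : 0 < ε / 4 := by positivity
  have hM : Summable (fun k => Real.exp (-s * levelGap k)) := LGS.levelGapSummable_all s hs
  have hMtail : ∀ᶠ i : ℕ in atTop, ∑' k, Real.exp (-s * levelGap (k + i)) < ε / 4 :=
    (tendsto_sum_nat_add (fun k => Real.exp (-s * levelGap k))).eventually (eventually_lt_nhds hε4)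
  obtain ⟨N, hN⟩ := Filter.eventually_atTop.1 hMtail
  obtain ⟨K1, lamT, hlamT, hT1⟩ := hTail s hs (ε / 4) hε4
  obtain ⟨βT, hβT⟩ := eventually_of_window L1 hlamT hT1
  set K : ℕ := K1 + N with hK
  have hε' : 0 < ε / (4 * ((K : ℝ) + 1)) := by positivity
  choose βk hβk using fun k => term_close L1 hUp hLow k hs hε'
  set β3 : ℝ := ∑ k ∈ Finset.range K, max (βk k) 0 with hβ3
  have hs2 : 0 < s / 2 := by positivity
  obtain ⟨βu, hβu⟩ := eventually_unit_le L1 hs2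
  refine ⟨max (max βT β3) βu, fun β hβ T hTs hTs2 => ?_⟩
  have hβT' : βT ≤ β := le_trans ((le_max_left _ _).trans (le_max_left _ _)) hβ
  have hβ3' : β3 ≤ β := le_trans ((le_max_right _ _).trans (le_max_left _ _)) hβ
  have hβu' : βu ≤ β := le_trans (le_max_right _ _) hβ
  obtain ⟨hβ1, hupos, hule⟩ := hβu β hβu'
  set u : ℝ := luscherLambda β L1 / L1 with hu
  -- `T ≥ 2`: `2u ≤ s ≤ T u`
  have hT2 : 2 ≤ T := by
    have h1 : (2 : ℝ) * u ≤ (T : ℝ) * u := by linarith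
    have h2 : (2 : ℝ) ≤ (T : ℝ) := le_of_mul_le_mul_right h1 hupos
    exact_mod_cast h2
  have hsum : Summable (fun k : ℕ => (levelValue su2Rep L1 β k / levelValue su2Rep L1 β 0) ^ T) :=
    summable_xpow L1 hβ1 hT2
  refine ⟨hsum, ?_⟩
  have hwin : s ≤ 2 * ((T : ℝ) * u) := by nlinarith [hupos.le]
  have htail : ∑' k : ℕ, (levelValue su2Rep L1 β (k + K1) / levelValue su2Rep L1 β 0) ^ T ≤ ε / 4 := hβT β hβT' T hwin
  set f : ℕ → ℝ := fun k => (levelValue su2Rep L1 β k / levelValue su2Rep L1 β 0) ^ T with hf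
  set g : ℕ → ℝ := fun k => Real.exp (-s * levelGap k) with hg
  have hβ0' : (0 : ℝ) ≤ β := by linarith
  have hf0 : ∀ k, 0 ≤ f k := fun k =>
    pow_nonneg (div_nonneg (levelValue_su2Rep_nonneg L1 hβ0' k) (levelValue_su2Rep_nonneg L1 hβ0' 0)) T
  have hg0 : ∀ k, 0 ≤ g k := fun k => (Real.exp_pos _).le
  have hfdec := hsum.sum_add_tsum_nat_add K
  have hgdec := hM.sum_add_tsum_nat_add K
  have hftail : ∑' i, f (i + K) ≤ ε / 4 := (OST.tsum_shift_le hsum hf0 K1 N).trans htail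
  have hgtail : ∑' i, g (i + K) < ε / 4 := hN K (by omega)
  have hftail0 : 0 ≤ ∑' i, f (i + K) := tsum_nonneg fun i => hf0 _
  have hgtail0 : 0 ≤ ∑' i, g (i + K) := tsum_nonneg fun i => hg0 _
  have hfin : ∑ k ∈ Finset.range K, |f k - g k| ≤ ∑ k ∈ Finset.range K, ε / (4 * ((K : ℝ) + 1)) := by
    refine Finset.sum_le_sum fun k hk => ?_
    have hBk' : βk k ≤ β := by
      have h1 : max (βk k) 0 ≤ β3 :=
        Finset.single_le_sum (f := fun k => max (βk k) 0) (fun i _ => le_max_right _ _) hk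
      exact le_trans (le_max_left _ _) (h1.trans hβ3')
    exact hβk k β hBk' T hTs hTs2
  have hfin' : ∑ k ∈ Finset.range K, |f k - g k| ≤ ε / 4 := by
    refine hfin.trans ?_
    rw [Finset.sum_const, Finset.card_range, nsmul_eq_mul]
    have hK1 : (0 : ℝ) < (K : ℝ) + 1 := by positivity
    rw [show (K : ℝ) * (ε / (4 * ((K : ℝ) + 1))) = ε / 4 * ((K : ℝ) / ((K : ℝ) + 1)) by field_simp]
    have : (K : ℝ) / ((K : ℝ) + 1) ≤ 1 := by rw [div_le_one hK1]; linarith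
    calc ε / 4 * ((K : ℝ) / ((K : ℝ) + 1)) ≤ ε / 4 * 1 := mul_le_mul_of_nonneg_left this hε4.le
      _ = ε / 4 := mul_one _
  have hfinabs : |∑ k ∈ Finset.range K, f k - ∑ k ∈ Finset.range K, g k| ≤ ε / 4 := by
    rw [← Finset.sum_sub_distrib]; exact (Finset.abs_sum_le_sum_abs _ _).trans hfin'
  rw [← hfdec, ← hgdec]
  have hsplit : (∑ k ∈ Finset.range K, f k + ∑' i, f (i + K)) - (∑ k ∈ Finset.range K, g k + ∑' i, g (i + K)) =
      (∑ k ∈ Finset.range K, f k - ∑ k ∈ Finset.range K, g k) + (∑' i, f (i + K) - ∑' i, g (i + K)) := by ring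
  rw [hsplit]
  calc |(∑ k ∈ Finset.range K, f k - ∑ k ∈ Finset.range K, g k) + (∑' i, f (i + K) - ∑' i, g (i + K))|
      ≤ |∑ k ∈ Finset.range K, f k - ∑ k ∈ Finset.range K, g k| + |∑' i, f (i + K) - ∑' i, g (i + K)| := abs_add_le _ _
    _ ≤ ε / 4 + (ε / 4 + ε / 4) := add_le_add hfinabs (by rw [abs_le]; constructor <;> linarith)
    _ ≤ ε := by linarith

/-- **The level ratio tends to `r_𝔥(s)` at `T = femtoSteps`** (from COARSE±(L₁) + COARSE-TAIL(L₁); `LevelGapSummable`, window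
bookkeeping from the tree): for all large `β`, `|levelRatio L₁ β ⌈sL₁/Λ⌉ − hTraceRatio s| ≤ ε`, together with `β ≥ 1` and `T ≥ 2`. -/
theorem levelRatio_close
    (hUp : ∀ k : ℕ, ∀ d : ℝ, d < levelGap k → ∃ lam0 : ℝ, 0 < lam0 ∧ ∀ lam : ℝ, 0 < lam → lam ≤ lam0 →
      ∀ β : ℝ, InFemtoWindow lam β L1 →
        levelValue su2Rep L1 β k ≤ Real.exp (-(d * luscherLambda β L1) / L1) * levelValue su2Rep L1 β 0)
    (hLow : ∀ k : ℕ, ∀ ε : ℝ, 0 < ε → ∃ lam0 : ℝ, 0 < lam0 ∧ ∀ lam : ℝ, 0 < lam → lam ≤ lam0 →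
      ∀ β : ℝ, InFemtoWindow lam β L1 →
        Real.exp (-((levelGap k + ε) * luscherLambda β L1) / L1) * levelValue su2Rep L1 β 0 ≤ levelValue su2Rep L1 β k)
    (hTail : ∀ s : ℝ, 0 < s → ∀ ε : ℝ, 0 < ε → ∃ K : ℕ, ∃ lam0 : ℝ, 0 < lam0 ∧ ∀ lam : ℝ, 0 < lam → lam ≤ lam0 →
      ∀ β : ℝ, InFemtoWindow lam β L1 → ∀ T : ℕ, s ≤ 2 * ((T : ℝ) * (luscherLambda β L1 / L1)) →
        ∑' k : ℕ, (levelValue su2Rep L1 β (k + K) / levelValue su2Rep L1 β 0) ^ T ≤ ε)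
    {s : ℝ} (hs : 0 < s) {ε : ℝ} (hε : 0 < ε) :
    ∃ β1 : ℝ, ∀ β : ℝ, β1 ≤ β → 1 ≤ β ∧ 2 ≤ femtoSteps s β L1 ∧
      |levelRatio L1 β (femtoSteps s β L1) - hTraceRatio s| ≤ ε := by
  have hε3 : 0 < ε / 3 := by positivity
  have h2s : 0 < 2 * s := by positivity
  obtain ⟨β2, h2⟩ := moment_close L1 hUp hLow hTail hs hε3
  obtain ⟨β2', h2'⟩ := moment_close L1 hUp hLow hTail h2s hε3
  have hs2 : 0 < s / 2 := by positivity
  obtain ⟨βw, hβw⟩ := exists_window_of_large_beta L1 (lam0 := s / 4) (by positivity)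
  refine ⟨max (max β2 β2') βw, fun β hβ => ?_⟩
  have hB2 : β2 ≤ β := le_trans ((le_max_left _ _).trans (le_max_left _ _)) hβ
  have hB2' : β2' ≤ β := le_trans ((le_max_right _ _).trans (le_max_left _ _)) hβ
  have hBw : βw ≤ β := le_trans (le_max_right _ _) hβ
  obtain ⟨lam, hlam, hlamle, hW⟩ := hβw β hBw
  have hβ1 : 1 ≤ β := hW.1
  set u : ℝ := luscherLambda β L1 / L1 with hu
  have hupos : 0 < u := unit_pos_of_window hlam hW
  have hule : u ≤ s / 2 := (unit_le_of_window hlam hW).trans (by linarith)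
  set T := femtoSteps s β L1 with hTdef
  obtain ⟨hT1, hT2⟩ := femtoSteps_mul_unit (L1 := L1) hs.le hlam hW
  have hT2' : (T : ℝ) * u ≤ s + 2 * u := by rw [hu]; linarith [hupos]
  have hTT1 : 2 * s ≤ ((2 * T : ℕ) : ℝ) * u := by push_cast; linarith
  have hTT2 : ((2 * T : ℕ) : ℝ) * u ≤ 2 * s + 2 * u := by push_cast; linarith
  have hTge2 : 2 ≤ T := by
    have h1 : (2 : ℝ) * u ≤ (T : ℝ) * u := by linarith
    have h2 : (2 : ℝ) ≤ (T : ℝ) := le_of_mul_le_mul_right h1 hupos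
    exact_mod_cast h2
  obtain ⟨hsum1, hm1⟩ := h2 β hB2 T hT1 hT2'
  obtain ⟨hsum2, hm2⟩ := h2' β hB2' (2 * T) hTT1 hTT2
  refine ⟨hβ1, hTge2, ?_⟩
  have hB0' : (0 : ℝ) ≤ β := by linarith
  have hone : 1 ≤ ∑' k : ℕ, (levelValue su2Rep L1 β k / levelValue su2Rep L1 β 0) ^ T := by
    have h := hsum1.le_tsum 0 (fun j _ =>
      pow_nonneg (div_nonneg (levelValue_su2Rep_nonneg L1 hB0' j) (levelValue_su2Rep_nonneg L1 hB0' 0)) T)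
    have h0 : (levelValue su2Rep L1 β 0 / levelValue su2Rep L1 β 0) ^ T = 1 := by
      rw [div_self (levelValue_zero_su2Rep_pos L1 β).ne', one_pow]
    rw [h0] at h; exact h
  have hone' : 1 ≤ ∑' k : ℕ, Real.exp (-s * levelGap k) := by
    have h := (LGS.levelGapSummable_all s hs).le_tsum 0 (fun j _ => (Real.exp_pos _).le)
    rw [levelGap_zero, mul_zero, Real.exp_zero] at h; exact h
  have hA' : 0 ≤ ∑' k : ℕ, Real.exp (-(2 * s) * levelGap k) := tsum_nonneg fun k => (Real.exp_pos _).le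
  have hA'B' : ∑' k : ℕ, Real.exp (-(2 * s) * levelGap k) ≤ ∑' k : ℕ, Real.exp (-s * levelGap k) := by
    refine Summable.tsum_le_tsum (fun k => ?_) (LGS.levelGapSummable_all (2 * s) h2s) (LGS.levelGapSummable_all s hs)
    refine Real.exp_le_exp.2 ?_
    have : 0 ≤ s * levelGap k := mul_nonneg hs.le (levelGap_nonneg k)
    linarith
  show |(∑' k : ℕ, (levelValue su2Rep L1 β k / levelValue su2Rep L1 β 0) ^ (2 * T)) /
      (∑' k : ℕ, (levelValue su2Rep L1 β k / levelValue su2Rep L1 β 0) ^ T) ^ 2 -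
      (∑' k : ℕ, Real.exp (-(2 * s) * levelGap k)) / (∑' k : ℕ, Real.exp (-s * levelGap k)) ^ 2| ≤ ε
  refine (ratio_sub_ratio_le hone hone' hA' hA'B').trans ?_
  linarith [hm1, hm2]

/-! ## §4 The reduction of S-BASE -/

/-- ★ **S-BASE at lattice size `L₁` from COARSE-UPPER(L₁) + COARSE-LOWER(L₁) + COARSE-TAIL(L₁)** (hypotheses = the verbatim bodies
of KTR r8 `CoarseNoIntruderAt L₁`, `CoarseLowerAt L₁`, and the fixed-lattice tail text; conclusion = S-BASE at `L₁`):
`∀ s > 0, ∀ ε > 0, ∃ β₁, ∀ β ≥ β₁, |traceRatio L₁ β (femtoSteps s β L₁) − hTraceRatio s| ≤ ε`.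
[cite: Luscher1983, §3] [cite: MontvayMunster1994, (3.145)] -/
theorem fixedLatticeTraceLaw_of_coarse
    (hUp : ∀ k : ℕ, ∀ d : ℝ, d < levelGap k → ∃ lam0 : ℝ, 0 < lam0 ∧ ∀ lam : ℝ, 0 < lam → lam ≤ lam0 →
      ∀ β : ℝ, InFemtoWindow lam β L1 →
        levelValue su2Rep L1 β k ≤ Real.exp (-(d * luscherLambda β L1) / L1) * levelValue su2Rep L1 β 0)
    (hLow : ∀ k : ℕ, ∀ ε : ℝ, 0 < ε → ∃ lam0 : ℝ, 0 < lam0 ∧ ∀ lam : ℝ, 0 < lam → lam ≤ lam0 →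
      ∀ β : ℝ, InFemtoWindow lam β L1 →
        Real.exp (-((levelGap k + ε) * luscherLambda β L1) / L1) * levelValue su2Rep L1 β 0 ≤ levelValue su2Rep L1 β k)
    (hTail : ∀ s : ℝ, 0 < s → ∀ ε : ℝ, 0 < ε → ∃ K : ℕ, ∃ lam0 : ℝ, 0 < lam0 ∧ ∀ lam : ℝ, 0 < lam → lam ≤ lam0 →
      ∀ β : ℝ, InFemtoWindow lam β L1 → ∀ T : ℕ, s ≤ 2 * ((T : ℝ) * (luscherLambda β L1 / L1)) →
        ∑' k : ℕ, (levelValue su2Rep L1 β (k + K) / levelValue su2Rep L1 β 0) ^ T ≤ ε) :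
    ∀ s : ℝ, 0 < s → ∀ ε : ℝ, 0 < ε → ∃ β1 : ℝ, ∀ β : ℝ, β1 ≤ β →
      |traceRatio L1 β (femtoSteps s β L1) - hTraceRatio s| ≤ ε := by
  intro s hs ε hε
  obtain ⟨β1, h⟩ := levelRatio_close L1 hUp hLow hTail hs hε
  refine ⟨β1, fun β hβ => ?_⟩
  obtain ⟨hβ1, hT2, hclose⟩ := h β hβ
  rw [traceRatio_eq_levelRatio L1 hβ1 hT2]
  exact hclose

omit [NeZero L1] in
/-- ★ **S-BASE of line «twolattice» from the three fixed-lattice statements at every lattice size** — conclusion = VERBATIM the body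
of the registered `TwoLattice.Stmt.stub_fixedLatticeTraceLaw` (skeleton sha16 a5c3dbcbf75f28d1). [cite: Luscher1983, §3] -/
theorem stmt_of_coarse
    (hUp : ∀ (L1 : ℕ) [NeZero L1], ∀ k : ℕ, ∀ d : ℝ, d < levelGap k → ∃ lam0 : ℝ, 0 < lam0 ∧ ∀ lam : ℝ, 0 < lam → lam ≤ lam0 →
      ∀ β : ℝ, InFemtoWindow lam β L1 →
        levelValue su2Rep L1 β k ≤ Real.exp (-(d * luscherLambda β L1) / L1) * levelValue su2Rep L1 β 0)
    (hLow : ∀ (L1 : ℕ) [NeZero L1], ∀ k : ℕ, ∀ ε : ℝ, 0 < ε → ∃ lam0 : ℝ, 0 < lam0 ∧ ∀ lam : ℝ, 0 < lam → lam ≤ lam0 →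
      ∀ β : ℝ, InFemtoWindow lam β L1 →
        Real.exp (-((levelGap k + ε) * luscherLambda β L1) / L1) * levelValue su2Rep L1 β 0 ≤ levelValue su2Rep L1 β k)
    (hTail : ∀ (L1 : ℕ) [NeZero L1], ∀ s : ℝ, 0 < s → ∀ ε : ℝ, 0 < ε → ∃ K : ℕ, ∃ lam0 : ℝ, 0 < lam0 ∧
      ∀ lam : ℝ, 0 < lam → lam ≤ lam0 → ∀ β : ℝ, InFemtoWindow lam β L1 →
        ∀ T : ℕ, s ≤ 2 * ((T : ℝ) * (luscherLambda β L1 / L1)) →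
          ∑' k : ℕ, (levelValue su2Rep L1 β (k + K) / levelValue su2Rep L1 β 0) ^ T ≤ ε) :
    ∀ (L1 : ℕ) [NeZero L1] (s : ℝ), 0 < s → ∀ ε : ℝ, 0 < ε → ∃ β1 : ℝ, ∀ β : ℝ, β1 ≤ β →
      |traceRatio L1 β (femtoSteps s β L1) - hTraceRatio s| ≤ ε :=
  fun L1 _ s hs ε hε => fixedLatticeTraceLaw_of_coarse L1 (hUp L1) (hLow L1) (hTail L1) s hs ε hε

end Base

end Summit.QuantumFields.YangMills.Theorems.FemtoTransferGap.TwoLattice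

end
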